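import Summits.QuantumFields.YangMills.Theorems.ColdStartUniversalityLatticeLangevinAutocorrelationTime
import Summits.QuantumFields.YangMills.Theorems.ColdStartUniversalityLatticeLangevinBakryEmeryUniformGap
import Summits.QuantumFields.YangMills.Theorems.ColdStartUniversalityLatticeLangevinPlaquetteVariance
import HarnessLib

/-!
# Route `ColdStartUniversality` (fixed-cut-off package): the INTEGRATED AUTOCORRELATION TIME of EVERY observable of the SU(2) SZZ dynamics
# on `(ℤ/L)³` is at most `1/(1 − 12|β'|)` lattice units, UNIFORMLY IN THE VOLUME, at `|β'| < 1/12`; Kipnis–Varadhan variance of the action density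

Helper file (seat `ym-line-csu-p1`, g27; `--supports stmt-QuantumFields-24809`).  g16's `integral_autocorrelation_le` bounds the integrated
autocorrelation time `τ_int(F) = ∫₀^∞ ⟨F, P_tF⟩_μ dt/‖F‖²_μ` by the inverse Doeblin rate `1/c(L,β')` (existential, degenerating with the volume).
With the volume-uniform `L²` gap of g25 (`wilson_spectralGap_uniform`, rate `1 − 12|β'|`) and reversibility (`⟨F, P_(2s)F⟩ = ‖P_sF‖²`):
* ★★ `wilson_autocorrelation_le_uniform` — for `|β'| < 1/12`, every realising kernel family and every centred continuous `F`:
  `∫₀^∞ ⟨F, P_tF⟩_(μ_β') dt ≤ ‖F‖²_(μ_β') / (1 − 12|β'|)` (and integrability, nonnegativity): **`τ_int ≤ 1/(1 − 12|β'|)` for every observable,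
  every `L`** — the quantity the instrument rows measure (MCMC error bars), now with an `L`-independent ceiling at strong coupling;
* ★★ `wilson_actionDensity_asymptoticVariance_uniform` — for the centred action density `F = S_W/#𝒫 − ⟨S_W/#𝒫⟩`:
  `∫₀^∞ ⟨F, P_tF⟩ dt ≤ 32/((1 − 12|β'|)²·#𝒫)`, i.e. the Kipnis–Varadhan asymptotic variance `σ²(F) = 2∫₀^∞⟨F,P_tF⟩` of the time-averaged action
  density is `O(1/L³)` with an explicit constant (`wilson_actionDensity_variance_uniform`).
[cite: RobertsRosenthal1997, Theorem 2.1] [cite: ShenZhuZhu2022, §4 Theorem 4.2]  THEOREMS ONLY, no definition, no sorry.  HONEST FRAMING: FIXED cut-off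
and fixed `|β'| < 1/12`; the route's scaling `β'_K → ∞` leaves the window; 24809 ASIDE not restated; no crux, rung or summit statement is proved; the
Yang–Mills mass gap is NOT proved.
-/

set_option autoImplicit false

noncomputable section

namespace Summit.QuantumFields.YangMills.Theorems.ColdStartUniversality

open MeasureTheory ProbabilityTheory Finset Filter Set Topology
open scoped BigOperators NNReal ENNReal
open Literature.Probability.Process Literature.MathematicalPhysics.QuantumFieldTheory
open Literature.MathematicalPhysics.QuantumLattice (fundamentalRep fundamentalLatticeRep continuous_fundamentalRep)

variable {L : ℕ} [NeZero L]

/-- ★★ **Volume-uniform bound on the integrated autocorrelation time** (`|β'| < 1/12`): for every realising kernel family and every centred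
continuous `F`, `t ↦ ⟨F, P_tF⟩_(μ_β')` is integrable on `(0,∞)`, nonnegative in integral, and `∫₀^∞ ⟨F, P_tF⟩ dt ≤ ‖F‖²_(μ_β')/(1 − 12|β'|)`
(`⟨F, P_(2s)F⟩ = ‖P_sF‖² ≤ e^(−2(1−12|β'|)s)‖F‖²`). [cite: RobertsRosenthal1997, Theorem 2.1] -/
theorem wilson_autocorrelation_le_uniform (L : ℕ) [NeZero L] (β' : ℝ) (hβ : |β'| < 1 / 12)
    (κ : ℝ≥0 → Kernel (GaugeConfig 3 L (Matrix.specialUnitaryGroup (Fin 2) ℂ)) (GaugeConfig 3 L (Matrix.specialUnitaryGroup (Fin 2) ℂ))) [∀ t, IsMarkovKernel (κ t)]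
    (hreal : ∀ (t : ℝ≥0) (x : (GaugeConfig 3 L (Matrix.specialUnitaryGroup (Fin 2) ℂ)))
        (Ω : Type) [MeasurableSpace Ω] (P : Measure Ω) [IsProbabilityMeasure P]
        (W : ℝ≥0 → Ω → (Edge 3 L × NoiseIdx 2 → ℝ)) (hW : IsFlatBrownian W P)
        (U : ℝ≥0 → Ω → (GaugeConfig 3 L (Matrix.specialUnitaryGroup (Fin 2) ℂ))),
        (∀ ω, U 0 ω = x) →
        (latticeLangevinDynamics (fundamentalLatticeRep 2) β').IsSolution (fundamentalRep (Fin 2))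
          hW.natFiltration P W U →
        κ t x = P.map (U t))
    (F : (GaugeConfig 3 L (Matrix.specialUnitaryGroup (Fin 2) ℂ)) → ℝ) (hF : Continuous F) (hF0 : ∫ x, F x ∂(wilsonMeasure (d := 3) (L := L) (fundamentalRep (Fin 2)) β') = 0) :
    IntegrableOn (fun t : ℝ => ∫ x, F x * (∫ y, F y ∂(κ t.toNNReal x)) ∂(wilsonMeasure (d := 3) (L := L) (fundamentalRep (Fin 2)) β')) (Ioi (0 : ℝ)) ∧
    0 ≤ ∫ t in Ioi (0 : ℝ), (∫ x, F x * (∫ y, F y ∂(κ t.toNNReal x)) ∂(wilsonMeasure (d := 3) (L := L) (fundamentalRep (Fin 2)) β')) ∧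
    ∫ t in Ioi (0 : ℝ), (∫ x, F x * (∫ y, F y ∂(κ t.toNNReal x)) ∂(wilsonMeasure (d := 3) (L := L) (fundamentalRep (Fin 2)) β')) ≤
      (∫ x, F x * F x ∂(wilsonMeasure (d := 3) (L := L) (fundamentalRep (Fin 2)) β')) / (1 - 12 * |β'|) := by
  classical
  haveI := secondCountableTopology_su2
  haveI := borelSpace_config L
  haveI : IsProbabilityMeasure (wilsonMeasure (d := 3) (L := L) (fundamentalRep (Fin 2)) β') :=
    isProbabilityMeasure_wilsonMeasure (d := 3) (L := L) (fundamentalRep (Fin 2)) (continuous_fundamentalRep (Fin 2)) β'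
  set c : ℝ := 1 - 12 * |β'| with hcdef
  have hc : 0 < c := by rw [hcdef]; linarith
  set μ : Measure (GaugeConfig 3 L (Matrix.specialUnitaryGroup (Fin 2) ℂ)) := (wilsonMeasure (d := 3) (L := L) (fundamentalRep (Fin 2)) β') with hμ
  set A : ℝ := ∫ x, F x * F x ∂μ with hA
  have hA0 : 0 ≤ A := integral_nonneg fun x => mul_self_nonneg _
  set φ : ℝ → ℝ := fun t => ∫ x, F x * (∫ y, F y ∂(κ t.toNNReal x)) ∂μ with hφ
  -- continuity of `φ`
  have hJ : Continuous (Function.uncurry fun (t : ℝ) (x : (GaugeConfig 3 L (Matrix.specialUnitaryGroup (Fin 2) ℂ))) => F x * ∫ y, F y ∂(κ t.toNNReal x)) :=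
    (hF.comp continuous_snd).mul ((continuous_transitionKernel_action β' κ hreal hF).comp
      ((continuous_real_toNNReal.comp continuous_fst).prodMk continuous_snd))
  have hφc : Continuous φ := continuous_integral_of_continuous_uncurry μ hJ
  -- `0 ≤ φ t ≤ e^(−ct) A`: reversibility + the uniform gap at time `t/2`
  have hφnn : ∀ t, 0 ≤ φ t := fun t => integral_mul_transition_self_nonneg L β' κ hreal t.toNNReal hF
  have hφle : ∀ t : ℝ, 0 ≤ t → φ t ≤ Real.exp (-c * t) * A := by
    intro t ht
    have hs : t.toNNReal = t.toNNReal / 2 + t.toNNReal / 2 := (add_halves _).symm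
    have h1 : φ t = ∫ x, (∫ y, F y ∂(κ (t.toNNReal / 2) x)) ^ 2 ∂μ := by
      show ∫ x, F x * (∫ y, F y ∂(κ t.toNNReal x)) ∂μ = _
      conv_lhs => rw [hs]
      exact integral_mul_transition_self_eq_sq L β' κ hreal (t.toNNReal / 2) hF
    have h2 := wilson_spectralGap_uniform L β' hβ κ hreal hF (t.toNNReal / 2)
    have hmF : ∫ z, F z ∂μ = 0 := hF0
    rw [hmF] at h2
    simp only [sub_zero] at h2
    have h3 : ∫ x, (F x) ^ 2 ∂μ = A := by
      rw [hA]; exact integral_congr_ae (ae_of_all _ fun x => by ring)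
    rw [h3] at h2
    have h4 : Real.exp (-2 * (1 - 12 * |β'|) * ((t.toNNReal / 2 : ℝ≥0) : ℝ)) = Real.exp (-c * t) := by
      congr 1
      rw [NNReal.coe_div, Real.coe_toNNReal t ht]
      push_cast
      rw [hcdef]; ring
    rw [h1, ← h4]
    exact h2
  set b : ℝ → ℝ := fun t => Real.exp (-c * t) * A with hb
  have hbi : IntegrableOn b (Ioi (0 : ℝ)) := (exp_neg_integrableOn_Ioi 0 hc).mul_const A
  have hφi : IntegrableOn φ (Ioi (0 : ℝ)) := by
    refine Integrable.mono' hbi hφc.aestronglyMeasurable ?_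
    filter_upwards [ae_restrict_mem measurableSet_Ioi] with t ht
    rw [Real.norm_eq_abs, abs_of_nonneg (hφnn t)]
    exact hφle t (le_of_lt ht)
  have hbint : ∫ t in Ioi (0 : ℝ), b t = A / c := by
    rw [hb]
    simp only [integral_mul_const]
    rw [integral_exp_mul_Ioi (by linarith : -c < 0) 0]
    simp only [mul_zero, Real.exp_zero]
    field_simp
  refine ⟨hφi, setIntegral_nonneg measurableSet_Ioi fun t _ => hφnn t, ?_⟩
  rw [← hbint]
  exact setIntegral_mono_on hφi hbi measurableSet_Ioi fun t ht => hφle t (le_of_lt ht)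

/-- ★★ **Kipnis–Varadhan variance of the time-averaged action density, volume-uniform**: for `|β'| < 1/12`, every realising kernel family,
with `F = S_W/#𝒫 − ∫ S_W/#𝒫 dμ_(β')` the centred action density: `∫₀^∞ ⟨F, P_tF⟩_(μ_β') dt ≤ 32/((1 − 12|β'|)²·#𝒫)` (so the asymptotic variance
`σ²(F) = 2∫₀^∞⟨F,P_tF⟩dt` of `T^(−1/2)∫₀ᵀ F(U_t)dt` in stationarity is `O(1/L³)`). [cite: RobertsRosenthal1997, Theorem 2.1] -/
theorem wilson_actionDensity_asymptoticVariance_uniform (L : ℕ) [NeZero L] (β' : ℝ) (hβ : |β'| < 1 / 12)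
    (κ : ℝ≥0 → Kernel (GaugeConfig 3 L (Matrix.specialUnitaryGroup (Fin 2) ℂ)) (GaugeConfig 3 L (Matrix.specialUnitaryGroup (Fin 2) ℂ))) [∀ t, IsMarkovKernel (κ t)]
    (hreal : ∀ (t : ℝ≥0) (x : (GaugeConfig 3 L (Matrix.specialUnitaryGroup (Fin 2) ℂ)))
        (Ω : Type) [MeasurableSpace Ω] (P : Measure Ω) [IsProbabilityMeasure P]
        (W : ℝ≥0 → Ω → (Edge 3 L × NoiseIdx 2 → ℝ)) (hW : IsFlatBrownian W P)
        (U : ℝ≥0 → Ω → (GaugeConfig 3 L (Matrix.specialUnitaryGroup (Fin 2) ℂ))),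
        (∀ ω, U 0 ω = x) →
        (latticeLangevinDynamics (fundamentalLatticeRep 2) β').IsSolution (fundamentalRep (Fin 2))
          hW.natFiltration P W U →
        κ t x = P.map (U t)) :
    ∫ t in Ioi (0 : ℝ), (∫ x, (wilsonAction (fundamentalRep (Fin 2)) x / (Fintype.card (Plaquette 3 L) : ℝ) - ∫ V', wilsonAction (fundamentalRep (Fin 2)) V' / (Fintype.card (Plaquette 3 L) : ℝ) ∂(wilsonMeasure (d := 3) (L := L) (fundamentalRep (Fin 2)) β')) *
        (∫ y, (wilsonAction (fundamentalRep (Fin 2)) y / (Fintype.card (Plaquette 3 L) : ℝ) - ∫ V', wilsonAction (fundamentalRep (Fin 2)) V' / (Fintype.card (Plaquette 3 L) : ℝ) ∂(wilsonMeasure (d := 3) (L := L) (fundamentalRep (Fin 2)) β')) ∂(κ t.toNNReal x)) ∂(wilsonMeasure (d := 3) (L := L) (fundamentalRep (Fin 2)) β')) ≤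
      32 / ((1 - 12 * |β'|) ^ 2 * (Fintype.card (Plaquette 3 L) : ℝ)) := by
  classical
  haveI := secondCountableTopology_su2
  haveI := borelSpace_config L
  haveI : IsProbabilityMeasure (wilsonMeasure (d := 3) (L := L) (fundamentalRep (Fin 2)) β') :=
    isProbabilityMeasure_wilsonMeasure (d := 3) (L := L) (fundamentalRep (Fin 2)) (continuous_fundamentalRep (Fin 2)) β'
  have hρ : 0 < 1 - 12 * |β'| := by linarith
  have hP : 0 < (Fintype.card (Plaquette 3 L) : ℝ) := card_plaquette_three_pos L
  set m : ℝ := ∫ V', wilsonAction (fundamentalRep (Fin 2)) V' / (Fintype.card (Plaquette 3 L) : ℝ) ∂(wilsonMeasure (d := 3) (L := L) (fundamentalRep (Fin 2)) β') with hm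
  set F : (GaugeConfig 3 L (Matrix.specialUnitaryGroup (Fin 2) ℂ)) → ℝ := fun x => wilsonAction (fundamentalRep (Fin 2)) x / (Fintype.card (Plaquette 3 L) : ℝ) - m with hFdef
  have hcont : Continuous fun x : (GaugeConfig 3 L (Matrix.specialUnitaryGroup (Fin 2) ℂ)) => wilsonAction (fundamentalRep (Fin 2)) x / (Fintype.card (Plaquette 3 L) : ℝ) := (continuous_wilsonAction_su2 (L := L)).div_const _
  have hF : Continuous F := hcont.sub continuous_const
  have hint : Integrable (fun x : (GaugeConfig 3 L (Matrix.specialUnitaryGroup (Fin 2) ℂ)) => wilsonAction (fundamentalRep (Fin 2)) x / (Fintype.card (Plaquette 3 L) : ℝ)) (wilsonMeasure (d := 3) (L := L) (fundamentalRep (Fin 2)) β') := integrable_of_continuous_of_compactSpace hcont _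
  have hF0 : ∫ x, F x ∂(wilsonMeasure (d := 3) (L := L) (fundamentalRep (Fin 2)) β') = 0 := by
    show ∫ x, (wilsonAction (fundamentalRep (Fin 2)) x / (Fintype.card (Plaquette 3 L) : ℝ) - m) ∂(wilsonMeasure (d := 3) (L := L) (fundamentalRep (Fin 2)) β') = 0
    rw [integral_sub hint (integrable_const m), integral_const]
    simp [hm]
  obtain ⟨-, -, h⟩ := wilson_autocorrelation_le_uniform L β' hβ κ hreal F hF hF0
  have hvar : ∫ x, F x * F x ∂(wilsonMeasure (d := 3) (L := L) (fundamentalRep (Fin 2)) β') ≤ 32 / ((1 - 12 * |β'|) * (Fintype.card (Plaquette 3 L) : ℝ)) := by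
    have hv := wilson_actionDensity_variance_uniform L β' hβ
    have e : ∫ x, F x * F x ∂(wilsonMeasure (d := 3) (L := L) (fundamentalRep (Fin 2)) β') = ∫ V, (wilsonAction (fundamentalRep (Fin 2)) V / (Fintype.card (Plaquette 3 L) : ℝ) - ∫ V', wilsonAction (fundamentalRep (Fin 2)) V' / (Fintype.card (Plaquette 3 L) : ℝ) ∂(wilsonMeasure (d := 3) (L := L) (fundamentalRep (Fin 2)) β')) ^ 2 ∂(wilsonMeasure (d := 3) (L := L) (fundamentalRep (Fin 2)) β') :=
      integral_congr_ae (ae_of_all _ fun x => by show (wilsonAction (fundamentalRep (Fin 2)) x / (Fintype.card (Plaquette 3 L) : ℝ) - m) * (wilsonAction (fundamentalRep (Fin 2)) x / (Fintype.card (Plaquette 3 L) : ℝ) - m) = _; rw [hm]; ring)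
    rw [e]; exact hv
  calc ∫ t in Ioi (0 : ℝ), (∫ x, F x * (∫ y, F y ∂(κ t.toNNReal x)) ∂(wilsonMeasure (d := 3) (L := L) (fundamentalRep (Fin 2)) β'))
      ≤ (∫ x, F x * F x ∂(wilsonMeasure (d := 3) (L := L) (fundamentalRep (Fin 2)) β')) / (1 - 12 * |β'|) := h
    _ ≤ (32 / ((1 - 12 * |β'|) * (Fintype.card (Plaquette 3 L) : ℝ))) / (1 - 12 * |β'|) := div_le_div_of_nonneg_right hvar hρ.le
    _ = 32 / ((1 - 12 * |β'|) ^ 2 * (Fintype.card (Plaquette 3 L) : ℝ)) := by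
        field_simp

end Summit.QuantumFields.YangMills.Theorems.ColdStartUniversality
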